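import Summits.BirchSwinnertonDyer.BirchSwinnertonDyer.Theorems.BiquadraticEisensteinDescentHeegnerTwistCouplingInSupplySymbolicMonskyOddDesignNoSeven
import HarnessLib

set_option linter.dupNamespace false -- `Summit.BirchSwinnertonDyer.BirchSwinnertonDyer.Theorems.…` (summit = sub)
set_option autoImplicit false

/-!
# Crux `HeegnerTwistCouplingInSupply` (stmt-BirchSwinnertonDyer-21381) — ODD bases with no prime `≡ 7 (mod 8)`: the odd ONE-STAGE door is open
# for SOME design `δ` iff it is open for `δ = 1` iff `dim (𝒦⁺(1) ∩ V×0) ≤ τ₀` (exact door)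

Route `BiquadraticEisensteinDescent` (cell `pub/bsd-wall`, width seat `bsd-wall-cm-bed-w3` g25; `--supports` 21381, helper). Sequel of
`…SymbolicMonskyOddDesignNoSeven` (w3 g25: on odd root-number-`−1` bases with no prime `≡ 7 (mod 8)` the `0 × V` and diagonal conditions of the
odd THEOREM A (`exists_patternFree_design_of_odd`, p752042) hold at `δ = 1`). Two more facts make the door EXACT on this family:
* `finrank_augKernel_inf_ker_snd_le_of_legit` — for EVERY base and every legitimate `δ` (`(δ,1) ∉ 𝒦`), the `V × 0` section of `𝒦⁺(δ) = 𝒦 ⊕ ⟨(δ,1)⟩` has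
  the SAME dimension as that of `𝒦⁺(1)`: both are in bijection with the kernel pairs `(x, c·1)` (`c ∈ 𝔽₂`) — memo THEOREM-A-w3g22's «`κ_u + ε`»
  is a `δ`-independent obstruction number; precisely `dim (𝒦⁺(1) ∩ V×0) ≤ dim (𝒦⁺(δ) ∩ V×0)` (the reverse inequality holds as well).
* ★★★ `odd_door_iff_of_noSeven` — EXACT ODD DOOR: on odd root-number-`−1` bases with no prime `≡ 7 (mod 8)`, SOME `(δ, τ)` satisfies the
  hypotheses of the odd THEOREM A (`(δ,1) ∉ 𝒦`, `dim 𝒦⁺(δ) = 2τ`, the three plane sections `≤ τ`) iff `dim (𝒦⁺(1) ∩ V×0) ≤ τ₀ = (dim 𝒦 + 1)/2`,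
  and then `δ = 1` works (`exists_patternFree_design_one_of_noSeven_odd`). Generalises the two-class theorem `odd_door_iff_of_negNegOne_false`
  (`{1,5}`, p754640). Numerics (w3 g25 probe21.py, 2 500 bases of the family, K ≤ 8, exhaustive over all `δ`): `δ = 1` fails in 381, and then
  no `δ` at all works (381/381).
HONEST FRAMING: RUNG-LEVEL corner layer (odd congruent `j = 1728` families `E_{n₀}`); `𝔽₂`-linear algebra attached to Monsky matrices
[cite: HeathBrown1994SelmerCongruentII, Appendix (Monsky), typescript pp. 39–41]; the crux as stated (C⁺), its registered stubs and BSD are NOT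
touched; nothing is closed. THEOREMS ONLY.
-/

namespace Summit.BirchSwinnertonDyer.BirchSwinnertonDyer.Theorems.SymbolicMonsky

section NoSevenOddDoorIff

open Module Matrix Literature.NumberTheory.EllipticCurves Literature.NumberTheory.EllipticCurves.HeathBrown1994
  Literature.NumberTheory.EllipticCurves.HeathBrown1994.Families
open Literature.NumberTheory.EllipticCurves.Rank1Residual

variable {k : ℕ} (base : SymbData (k + 1))

/-- **The `V × 0` section of the augmented kernel does not depend on the (legitimate) design**: `dim (𝒦⁺(1) ∩ V×0) ≤ dim (𝒦⁺(δ) ∩ V×0)`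
whenever `(δ, 1) ∉ 𝒦`. Both sections are parametrised by `𝒦₁ := {(x, y) ∈ 𝒦 : y ∈ ⟨1⟩}`: `𝒦⁺(1) ∩ V×0` is the image of `𝒦₁` under
`(x, y) ↦ (x + y₀·1, 0)` and `(x, y) ↦ (x + y₀·δ, 0)` EMBEDS `𝒦₁` into `𝒦⁺(δ) ∩ V×0` (`y₀` = the common value of the constant vector `y`).
[cite: HeathBrown1994SelmerCongruentII, Appendix (Monsky), typescript pp. 39–41] -/
theorem finrank_augKernel_inf_ker_snd_le_of_legit (δ : Fin (k + 1) → ZMod 2)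
    (hδ : ((δ, fun _ => (1 : ZMod 2)) : (Fin (k + 1) → ZMod 2) × (Fin (k + 1) → ZMod 2)) ∉ base.virtualKernel) :
    finrank (ZMod 2) ↥(base.augKernel (fun _ => 1) ⊓
        LinearMap.ker (LinearMap.snd (ZMod 2) (Fin (k + 1) → ZMod 2) (Fin (k + 1) → ZMod 2))) ≤
      finrank (ZMod 2) ↥(base.augKernel δ ⊓
        LinearMap.ker (LinearMap.snd (ZMod 2) (Fin (k + 1) → ZMod 2) (Fin (k + 1) → ZMod 2))) := by
  have h2 : ∀ x : ZMod 2, x + x = 0 := by decide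
  -- `𝒦₁ = {(x, y) ∈ 𝒦 : y ∈ ⟨1⟩}`
  set K₁ := base.virtualKernel ⊓ Submodule.comap (LinearMap.snd (ZMod 2) (Fin (k + 1) → ZMod 2) (Fin (k + 1) → ZMod 2))
    (Submodule.span (ZMod 2) {fun _ : Fin (k + 1) => (1 : ZMod 2)}) with hK₁
  -- evaluation at the index `0`, and the maps `(x, y) ↦ (x + y₀·w, 0)`
  set ev0 : (Fin (k + 1) → ZMod 2) →ₗ[ZMod 2] ZMod 2 := LinearMap.proj 0 with hev0
  have hψ : ∀ w : Fin (k + 1) → ZMod 2, ∃ ψ : ((Fin (k + 1) → ZMod 2) × (Fin (k + 1) → ZMod 2)) →ₗ[ZMod 2]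
      ((Fin (k + 1) → ZMod 2) × (Fin (k + 1) → ZMod 2)), ∀ q, ψ q = (fun b => q.1 b + q.2 0 * w b, 0) := by
    intro w
    refine ⟨(LinearMap.inl (ZMod 2) (Fin (k + 1) → ZMod 2) (Fin (k + 1) → ZMod 2)).comp
      (LinearMap.fst (ZMod 2) (Fin (k + 1) → ZMod 2) (Fin (k + 1) → ZMod 2) +
        (LinearMap.toSpanSingleton (ZMod 2) (Fin (k + 1) → ZMod 2) w).comp
          (ev0.comp (LinearMap.snd (ZMod 2) (Fin (k + 1) → ZMod 2) (Fin (k + 1) → ZMod 2)))), fun q => ?_⟩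
    refine Prod.ext (funext fun b => ?_) rfl
    simp [hev0]
  obtain ⟨ψ₁, hψ₁⟩ := hψ (fun _ => 1)
  obtain ⟨ψδ, hψδ⟩ := hψ δ
  -- (i) `𝒦⁺(1) ∩ V×0 ⊆ ψ₁(𝒦₁)`
  have hle1 : base.augKernel (fun _ => 1) ⊓ LinearMap.ker (LinearMap.snd (ZMod 2) (Fin (k + 1) → ZMod 2) (Fin (k + 1) → ZMod 2)) ≤
      K₁.map ψ₁ := by
    intro p hp
    obtain ⟨hpW, hp0⟩ := Submodule.mem_inf.1 hp
    obtain ⟨q, hq, c, rfl⟩ := exists_of_mem_augKernel base (fun _ => 1) hpW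
    rw [LinearMap.mem_ker, LinearMap.snd_apply] at hp0
    have hq2 : ∀ b, q.2 b = c := fun b => by
      have := congrFun hp0 b
      simp only [Prod.snd_add, Prod.smul_snd, Pi.add_apply, Pi.smul_apply, smul_eq_mul, mul_one, Pi.zero_apply] at this
      linear_combination this - h2 c
    have hqK : q ∈ K₁ := by
      refine Submodule.mem_inf.2 ⟨hq, ?_⟩
      rw [Submodule.mem_comap, LinearMap.snd_apply, Submodule.mem_span_singleton]
      exact ⟨c, funext fun b => by simp [hq2 b]⟩
    refine Submodule.mem_map.2 ⟨q, hqK, ?_⟩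
    rw [hψ₁]
    refine Prod.ext (funext fun b => ?_) ?_
    · simp [hq2]
    · exact hp0.symm
  -- (ii) `ψδ` embeds `𝒦₁` into `𝒦⁺(δ) ∩ V×0`
  have hle2 : K₁.map ψδ ≤ base.augKernel δ ⊓ LinearMap.ker (LinearMap.snd (ZMod 2) (Fin (k + 1) → ZMod 2) (Fin (k + 1) → ZMod 2)) := by
    intro p hp
    obtain ⟨q, hq, rfl⟩ := Submodule.mem_map.1 hp
    obtain ⟨hqK, hq1⟩ := Submodule.mem_inf.1 hq
    rw [Submodule.mem_comap, LinearMap.snd_apply, Submodule.mem_span_singleton] at hq1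
    obtain ⟨c, hc⟩ := hq1
    have hq2 : ∀ b, q.2 b = c := fun b => by
      have := congrFun hc b
      simp only [Pi.smul_apply, smul_eq_mul, mul_one] at this
      exact this.symm
    rw [hψδ]
    refine Submodule.mem_inf.2 ⟨?_, by rw [LinearMap.mem_ker, LinearMap.snd_apply]⟩
    have e : ((fun b => q.1 b + q.2 0 * δ b), (0 : Fin (k + 1) → ZMod 2)) = q + c • (δ, fun _ => (1 : ZMod 2)) := by
      refine Prod.ext (funext fun b => ?_) (funext fun b => ?_)
      · simp [hq2]
      · simp [hq2, h2]
    rw [e]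
    exact add_smul_mem_augKernel base δ hqK c
  have hinj : Function.Injective (ψδ.domRestrict K₁) := by
    rw [LinearMap.injective_domRestrict_iff, disjoint_iff, Submodule.eq_bot_iff]
    intro q hq
    obtain ⟨hqK₁, hqψ⟩ := Submodule.mem_inf.1 hq
    obtain ⟨hqK, hq1⟩ := Submodule.mem_inf.1 hqK₁
    rw [Submodule.mem_comap, LinearMap.snd_apply, Submodule.mem_span_singleton] at hq1
    obtain ⟨c, hc⟩ := hq1
    have hq2 : ∀ b, q.2 b = c := fun b => by
      have := congrFun hc b
      simp only [Pi.smul_apply, smul_eq_mul, mul_one] at this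
      exact this.symm
    rw [LinearMap.mem_ker, hψδ] at hqψ
    have hx : ∀ b, q.1 b + c * δ b = 0 := fun b => by
      have := congrFun (congrArg Prod.fst hqψ) b
      simp only [hq2] at this
      exact this
    -- `c = 0`: else `q = (δ, 1) ∈ 𝒦`
    have hc0 : c = 0 := by
      rcases (by decide : ∀ x : ZMod 2, x = 0 ∨ x = 1) c with h | h
      · exact h
      · exfalso
        apply hδ
        have hq' : q = (δ, fun _ => (1 : ZMod 2)) := by
          refine Prod.ext (funext fun b => ?_) (funext fun b => ?_)
          · have := hx b
            rw [h, one_mul] at this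
            linear_combination this - h2 (δ b)
          · rw [hq2 b, h]
        rw [← hq']
        exact hqK
    have hq1' : q.1 = 0 := funext fun b => by
      have := hx b
      rw [hc0, zero_mul, add_zero] at this
      exact this
    have hq2' : q.2 = 0 := funext fun b => by rw [hq2 b, hc0]; rfl
    exact Prod.ext hq1' hq2'
  have hfin : finrank (ZMod 2) ↥(K₁.map ψδ) = finrank (ZMod 2) ↥K₁ := by
    rw [← LinearMap.range_domRestrict]
    exact LinearMap.finrank_range_of_inj hinj
  calc finrank (ZMod 2) ↥(base.augKernel (fun _ => 1) ⊓
          LinearMap.ker (LinearMap.snd (ZMod 2) (Fin (k + 1) → ZMod 2) (Fin (k + 1) → ZMod 2)))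
      ≤ finrank (ZMod 2) ↥(K₁.map ψ₁) := Submodule.finrank_mono hle1
    _ ≤ finrank (ZMod 2) ↥K₁ := Submodule.finrank_map_le _ _
    _ = finrank (ZMod 2) ↥(K₁.map ψδ) := hfin.symm
    _ ≤ _ := Submodule.finrank_mono hle2

/-- ★★★ **EXACT ODD ONE-STAGE DOOR on bases with no prime `≡ 7 (mod 8)`.** For a root-number-`−1` odd base `E_{P₀⋯P_k}` all of whose primes
`≡ 3 (mod 4)` are `≡ 3 (mod 8)`: SOME `(δ, τ)` satisfies the hypotheses of the odd THEOREM A (`(δ,1) ∉ 𝒦`, `dim 𝒦⁺(δ) = 2τ`, the three plane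
sections of `𝒦⁺(δ)` of dimension `≤ τ`) if and only if `dim (𝒦⁺(1) ∩ V×0) ≤ τ₀ = (dim 𝒦 + 1)/2` — and then `δ = 1` works. (⟹: the `V × 0`
section is design-independent, `finrank_augKernel_inf_ker_snd_le_of_legit`; ⟸: `…OddDesignNoSeven`.)
[cite: HeathBrown1994SelmerCongruentII, Appendix (Monsky), typescript pp. 39–41] -/
theorem odd_door_iff_of_noSeven
    (h7 : ∀ b, negNegOne (base.cls b) = true → negTwo (base.cls b) = true)
    (hroot : (∑ b, (bz (negNegOne (base.cls b)) + bz (negTwo (base.cls b)))) = 1) :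
    (∃ (δ : Fin (k + 1) → ZMod 2) (τ : ℕ),
      ((δ, fun _ => (1 : ZMod 2)) : (Fin (k + 1) → ZMod 2) × (Fin (k + 1) → ZMod 2)) ∉ base.virtualKernel ∧
      finrank (ZMod 2) ↥(base.augKernel δ) = 2 * τ ∧
      finrank (ZMod 2) ↥(base.augKernel δ ⊓
        LinearMap.ker (LinearMap.snd (ZMod 2) (Fin (k + 1) → ZMod 2) (Fin (k + 1) → ZMod 2))) ≤ τ ∧
      finrank (ZMod 2) ↥(base.augKernel δ ⊓
        LinearMap.ker (LinearMap.fst (ZMod 2) (Fin (k + 1) → ZMod 2) (Fin (k + 1) → ZMod 2))) ≤ τ ∧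
      finrank (ZMod 2) ↥(base.augKernel δ ⊓ LinearMap.ker (LinearMap.fst (ZMod 2) (Fin (k + 1) → ZMod 2) (Fin (k + 1) → ZMod 2) +
        LinearMap.snd (ZMod 2) (Fin (k + 1) → ZMod 2) (Fin (k + 1) → ZMod 2))) ≤ τ) ↔
    finrank (ZMod 2) ↥(base.augKernel (fun _ => 1) ⊓
      LinearMap.ker (LinearMap.snd (ZMod 2) (Fin (k + 1) → ZMod 2) (Fin (k + 1) → ZMod 2))) ≤
        (finrank (ZMod 2) ↥base.virtualKernel + 1) / 2 := by
  constructor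
  · rintro ⟨δ, τ, hδ, hdim, h1, -, -⟩
    have hτ : τ = (finrank (ZMod 2) ↥base.virtualKernel + 1) / 2 := by
      have e := finrank_augKernel_eq base δ hδ
      rw [hdim] at e
      omega
    rw [← hτ]
    exact (finrank_augKernel_inf_ker_snd_le_of_legit base δ hδ).trans h1
  · intro h1
    obtain ⟨r, hr⟩ := odd_finrank_virtualKernel base hroot
    have hδ := one_one_not_mem_virtualKernel base hroot
    refine ⟨fun _ => 1, (finrank (ZMod 2) ↥base.virtualKernel + 1) / 2, hδ, ?_, h1, ?_, ?_⟩
    · rw [finrank_augKernel_eq base (fun _ => 1) hδ, hr]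
      omega
    · have := two_mul_finrank_augKernel_one_inf_ker_fst_le_of_noSeven base h7 hroot
      omega
    · have := two_mul_finrank_augKernel_one_inf_diag_le_of_noSeven base h7 hroot
      omega

end NoSevenOddDoorIff

end Summit.BirchSwinnertonDyer.BirchSwinnertonDyer.Theorems.SymbolicMonsky
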